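import Literature.NumberTheory.Rogawski1990.ArchCentralValueTransferRayScaling   -- ★ p835298 ∕ ★ p834860: the one-sided rescaling lemmas for (14.2.1) ∕ (4.3.1) ∕ the Weil form
import HarnessLib

/-!
# The thirteen-conjunct archimedean transfer letter #77 (★ `ArchTransfersExistCanonical`) IS HAAR-NORMALISATION-FREE: its truth value does not depend
# on the choice of the Haar measures `(ν′, ν, ν_H)` — INDEPENDENT rescalings of all three are absorbed by the witnesses
(Rogawski, *Automorphic Representations of Unitary Groups in Three Variables* (1990), §1.7 p. 6, §4.3 (4.3.1) p. 43, §14.2 (14.2.1) pp. 232–233, §14.3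
pp. 233–234; ★ `TransferFactsCanonical` ED. 3 remark «no absolute normalisation is asserted at `∞` — rescaling-invariant statements»)

Topic `NumberTheory/Rogawski1990`; namespace `Literature.NumberTheory.Rogawski1990`.  THEOREMS ONLY (no definition, no instance, no named fact, no notation,
no `sorry`).  Cell `pub/hodgecm-mathlib`, ENGINE T1 (crux H413 = `stmt-HodgeConjecture-24833`); author F0P3a-p06 (g8) (T6-L2 pen).  Part 3 of the (S-d) ray
files (★ p834860 `ArchCentralValueTransferRay`, ★ p835298 `ArchCentralValueTransferRayScaling`): the CONTRAST the referee's erratum R1-162-O2 draws — #77 (the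
T1 line's `hAT₃`∕T6-L1's head, WITHOUT the central-value clause) is invariant under INDEPENDENT rescalings `(ν′, ν, ν_H) ↦ (c′•ν′, c•ν, c_H•ν_H)`, hence holds at
one Haar frame iff at every Haar frame, whereas (S-d) (parts 1–2) tolerates only the simultaneous `(c•ν′, c•ν)`.  Kernel-checked; books count-neutral; nothing
here proves #77.

THE ARGUMENT.  From a system `(m′, m, m_H, t′, t, t_H)` at `(ν′, ν, ν_H)` pass to `(c′•m′, c•m, c_H•m_H, t′, t, t_H)`: admissibility (★ `IsAdmissibleOn.smul`) and
the Weil forms (★ `IsQuotientOf.smul_of_eq_nnreal_smul`) rescale; the torus transports (C′)(C)(C′G)(C_H) do not read the families; the inner-transfer ∃-form (v)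
survives `m′ ↦ c′•m′` with `a ↦ c′•a` (`IsInnerTransferRel.smul_measure_left`, below) and `m ↦ c•m` with `a ↦ c⁻¹•a` (★ `…smul_measure_right`); the endoscopic
∃-form (vi) survives `m′ ↦ c′•m′` with `a^H ↦ c′•a^H` (★ `IsDeltaTransferRel.smul_measure_right`) and `m_H ↦ c_H•m_H` with `a^H ↦ c_H⁻¹•a^H`
(`IsDeltaTransferRel.smul_measure_left`, below).  Non-degeneracy (iv) carries no measure.

* §1 (abstract, then the `arch` dress) `IsInnerTransferRel.smul_measure_left` ∕ `IsInnerTransferExistsRel.smul_measure_left`, `IsDeltaTransferRel.smul_measure_left` ∕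
  `IsDeltaTransferExistsRel.smul_measure_left`, `IsArchInnerTransferExists.smul_measure_left`, `IsArchDeltaTransferExists.smul_measure_left`.
* §2 **`ArchTransfersExistCanonical.nnreal_smul`** — `#77 (ν′, ν, ν_H) → #77 (c′•ν′, c•ν, c_H•ν_H)` for Haar right-invariant measures and `c′, c, c_H ≠ 0`;
  **`ArchTransfersExistCanonical.of_isHaarMeasure`** — for any two triples of Haar right-invariant measures, #77 at one implies #77 at the other (so the letter is a
  property of `(L, H′, T)` alone).
HONEST LABEL: HC_CM is proved only modulo the printed citations until rung 0 closes; this file is unconditional and proves no printed statement.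

## References
* [Rogawski1990] J. D. Rogawski, *Automorphic Representations of Unitary Groups in Three Variables*, Ann. of Math. Stud. 123 (1990), §1.7 p. 6, §4.3 (4.3.1) p. 43,
  §14.2 (14.2.1) pp. 232–233, §14.3 pp. 233–234.
* [DeitmarEchterhoff2014] A. Deitmar, S. Echterhoff, *Principles of Harmonic Analysis*, 2nd ed. (2014), Thm. 1.5.3.
-/

noncomputable section

open MeasureTheory Measure NumberField NumberField.InfinitePlace IsDedekindDomain Filter Topology
open Literature.MeasureTheory.Group
open scoped ENNReal NNReal Matrix ComplexOrder Classical

namespace Literature.NumberTheory.Rogawski1990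

open Literature.NumberTheory.Automorphic Literature.NumberTheory.GaloisRepresentations
open Literature.AlgebraicGeometry.ShimuraVarieties (unitaryGroup hermForm)

/-! ## §1 Rescaling the OTHER family in (14.2.1) and (4.3.1) -/

section Abstract

variable {A B : Type*} [Group A] [Group B] [∀ γ : A, MeasurableSpace (A ⧸ Subgroup.centralizer ({γ} : Set A))]
  [∀ γ : B, MeasurableSpace (B ⧸ Subgroup.centralizer ({γ} : Set B))]

/-- **(14.2.1) for `(κ•m′, m)` from (14.2.1) for `(m′, m)`, compensating on the partner**: if `f′ → f` for `(m′, m)` then `f′ → κ.toReal • f` for `(κ•m′, m)`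
(`Φ^st` is linear in the family and in the function). [cite: Rogawski1990, §14.2 (14.2.1) p. 232; §4.1 (4.1.1) p. 39] -/
theorem IsInnerTransferRel.smul_measure_left {corr : B → A → Prop} {stB : B → B → Prop} {stA : A → A → Prop} {regA : A → Prop}
    {m' : OrbitalMeasureFamily B} {m : OrbitalMeasureFamily A} {f' : B → ℂ} {f : A → ℂ}
    (h : IsInnerTransferRel corr stB stA regA m' m f' f) (κ : ℝ≥0∞) :
    IsInnerTransferRel corr stB stA regA (HSMul.hSMul κ m') m f' ((κ.toReal : ℂ) • f) := by
  intro γ hγ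
  obtain ⟨h1, h2⟩ := h γ hγ
  refine ⟨fun γ' hc => ?_, fun hno => ?_⟩
  · rw [stableOrbitalIntegralRel_smul, stableOrbitalIntegralRel_smul_fun, h1 γ' hc]
  · rw [stableOrbitalIntegralRel_smul_fun, h2 hno, mul_zero]

/-- The ∃-form: partners in `Smooth_A` for `(m′, m)` and closure of `Smooth_A` under scalars give partners for `(κ•m′, m)`.
[cite: Rogawski1990, §14.2 (14.2.1) pp. 232–233] -/
theorem IsInnerTransferExistsRel.smul_measure_left {corr : B → A → Prop} {stB : B → B → Prop} {stA : A → A → Prop} {regA : A → Prop}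
    {m' : OrbitalMeasureFamily B} {m : OrbitalMeasureFamily A} {SmoothB : (B → ℂ) → Prop} {SmoothA : (A → ℂ) → Prop}
    (h : IsInnerTransferExistsRel corr stB stA regA m' m SmoothB SmoothA) (hA : ∀ (z : ℂ) (f : A → ℂ), SmoothA f → SmoothA (z • f)) (κ : ℝ≥0∞) :
    IsInnerTransferExistsRel corr stB stA regA (HSMul.hSMul κ m') m SmoothB SmoothA := fun f' hf' => by
  obtain ⟨f, hf, hrel⟩ := h f' hf'
  exact ⟨_, hA _ f hf, hrel.smul_measure_left κ⟩

/-- **(4.3.1) for `(κ•m_H, m_G)` from (4.3.1) for `(m_H, m_G)`, compensating on `f^H`**: if `f → f^H` for `(m_H, m_G)` then `f → κ.toReal⁻¹ • f^H` for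
`(κ•m_H, m_G)` (`κ ≠ 0, ⊤`; `Φ^st_H` is linear in the family and in `f^H`). [cite: Rogawski1990, §4.3 (4.3.1) p. 43] -/
theorem IsDeltaTransferRel.smul_measure_left {R : A → B → Prop} {stA : A → A → Prop} {regA : A → Prop} {T : TransferFactorData A B R}
    {mH : OrbitalMeasureFamily A} {mG : OrbitalMeasureFamily B} {fH : A → ℂ} {f : B → ℂ}
    (h : IsDeltaTransferRel R stA regA T mH mG fH f) {κ : ℝ≥0∞} (h0 : κ ≠ 0) (htop : κ ≠ ⊤) :
    IsDeltaTransferRel R stA regA T (HSMul.hSMul κ mH) mG (((κ.toReal : ℂ))⁻¹ • fH) f := by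
  have hκ : (κ.toReal : ℂ) ≠ 0 := by exact_mod_cast (ENNReal.toReal_pos h0 htop).ne'
  intro a ha
  rw [stableOrbitalIntegralRel_smul, stableOrbitalIntegralRel_smul_fun, h a ha, ← mul_assoc, mul_inv_cancel₀ hκ, one_mul]

/-- The ∃-form: `f^H`'s in `Smooth_H` for `(m_H, m_G)` and closure of `Smooth_H` under scalars give `f^H`'s for `(κ•m_H, m_G)` (`κ ≠ 0, ⊤`).
[cite: Rogawski1990, §4.9 Prop. 4.9.1 (a) p. 55; §14.3 p. 234] -/
theorem IsDeltaTransferExistsRel.smul_measure_left {R : A → B → Prop} {stA : A → A → Prop} {regA : A → Prop} {T : TransferFactorData A B R}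
    {mH : OrbitalMeasureFamily A} {mG : OrbitalMeasureFamily B} {SmoothG : (B → ℂ) → Prop} {SmoothH : (A → ℂ) → Prop}
    (h : IsDeltaTransferExistsRel R stA regA T mH mG SmoothG SmoothH) (hH : ∀ (z : ℂ) (fH : A → ℂ), SmoothH fH → SmoothH (z • fH))
    {κ : ℝ≥0∞} (h0 : κ ≠ 0) (htop : κ ≠ ⊤) :
    IsDeltaTransferExistsRel R stA regA T (HSMul.hSMul κ mH) mG SmoothG SmoothH := fun f hf => by
  obtain ⟨fH, hfH, hT⟩ := h f hf
  exact ⟨_, hH _ fH hfH, hT.smul_measure_left h0 htop⟩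

end Abstract

section Arch

variable (L : Type) [Field L] [NumberField L] [IsCMField L] (H' : Matrix (Fin 3) (Fin 3) L)

/-- The ∃-form of (14.2.1) at `∞` on smooth test functions survives `m′ ↦ κ•m′` (partner `a ↦ κ.toReal • a`). [cite: Rogawski1990, §14.2 (14.2.1) pp. 232–233] -/
theorem IsArchInnerTransferExists.smul_measure_left
    {_hγ' : ∀ γ : UnitaryGroup.arch (↥(maximalRealSubfield L)) L (IsCMField.complexConj L) 3 H',
      MeasurableSpace (UnitaryGroup.arch (↥(maximalRealSubfield L)) L (IsCMField.complexConj L) 3 H' ⧸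
        Subgroup.centralizer ({γ} : Set (UnitaryGroup.arch (↥(maximalRealSubfield L)) L (IsCMField.complexConj L) 3 H')))}
    {_hγ : ∀ γ : UnitaryGroup.arch (↥(maximalRealSubfield L)) L (IsCMField.complexConj L) 3
        (Matrix.of fun i j : Fin 3 => if i.val + j.val + 1 = 3 then (1 : L) else 0),
      MeasurableSpace (UnitaryGroup.arch (↥(maximalRealSubfield L)) L (IsCMField.complexConj L) 3
          (Matrix.of fun i j : Fin 3 => if i.val + j.val + 1 = 3 then (1 : L) else 0) ⧸
        Subgroup.centralizer ({γ} : Set (UnitaryGroup.arch (↥(maximalRealSubfield L)) L (IsCMField.complexConj L) 3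
          (Matrix.of fun i j : Fin 3 => if i.val + j.val + 1 = 3 then (1 : L) else 0))))}
    {m' : OrbitalMeasureFamily (UnitaryGroup.arch (↥(maximalRealSubfield L)) L (IsCMField.complexConj L) 3 H')}
    {m : OrbitalMeasureFamily (UnitaryGroup.arch (↥(maximalRealSubfield L)) L (IsCMField.complexConj L) 3
      (Matrix.of fun i j : Fin 3 => if i.val + j.val + 1 = 3 then (1 : L) else 0))}
    (h : IsArchInnerTransferExists L H' m' m (ArchSmooth L 3 H')
      (ArchSmooth L 3 (Matrix.of fun i j : Fin 3 => if i.val + j.val + 1 = 3 then (1 : L) else 0))) (κ : ℝ≥0∞) :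
    IsArchInnerTransferExists L H' (HSMul.hSMul κ m') m (ArchSmooth L 3 H')
      (ArchSmooth L 3 (Matrix.of fun i j : Fin 3 => if i.val + j.val + 1 = 3 then (1 : L) else 0)) :=
  IsInnerTransferExistsRel.smul_measure_left h (fun z _ hf => ArchSmooth.smul L hf z) κ

/-- The ∃-form of §14.3 at `∞` on smooth test functions survives `m_H ↦ κ•m_H` (`κ ≠ 0, ⊤`; `a^H ↦ κ.toReal⁻¹ • a^H`). [cite: Rogawski1990, §14.3 p. 234] -/
theorem IsArchDeltaTransferExists.smul_measure_left
    {_ha : ∀ a : (UnitaryGroup.arch (↥(maximalRealSubfield L)) L (IsCMField.complexConj L) 2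
          (Matrix.of fun i j : Fin 2 => if i.val + j.val + 1 = 2 then (1 : L) else 0) ×
        UnitaryGroup.arch (↥(maximalRealSubfield L)) L (IsCMField.complexConj L) 1
          (Matrix.of fun i j : Fin 1 => if i.val + j.val + 1 = 1 then (1 : L) else 0)),
      MeasurableSpace ((UnitaryGroup.arch (↥(maximalRealSubfield L)) L (IsCMField.complexConj L) 2
          (Matrix.of fun i j : Fin 2 => if i.val + j.val + 1 = 2 then (1 : L) else 0) ×
        UnitaryGroup.arch (↥(maximalRealSubfield L)) L (IsCMField.complexConj L) 1
          (Matrix.of fun i j : Fin 1 => if i.val + j.val + 1 = 1 then (1 : L) else 0)) ⧸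
        Subgroup.centralizer ({a} : Set (UnitaryGroup.arch (↥(maximalRealSubfield L)) L (IsCMField.complexConj L) 2
          (Matrix.of fun i j : Fin 2 => if i.val + j.val + 1 = 2 then (1 : L) else 0) ×
        UnitaryGroup.arch (↥(maximalRealSubfield L)) L (IsCMField.complexConj L) 1
          (Matrix.of fun i j : Fin 1 => if i.val + j.val + 1 = 1 then (1 : L) else 0))))}
    {_hγ : ∀ γ : UnitaryGroup.arch (↥(maximalRealSubfield L)) L (IsCMField.complexConj L) 3 H',
      MeasurableSpace (UnitaryGroup.arch (↥(maximalRealSubfield L)) L (IsCMField.complexConj L) 3 H' ⧸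
        Subgroup.centralizer ({γ} : Set (UnitaryGroup.arch (↥(maximalRealSubfield L)) L (IsCMField.complexConj L) 3 H')))}
    {T : ArchTransferFactor L H'}
    {mH : OrbitalMeasureFamily (UnitaryGroup.arch (↥(maximalRealSubfield L)) L (IsCMField.complexConj L) 2
          (Matrix.of fun i j : Fin 2 => if i.val + j.val + 1 = 2 then (1 : L) else 0) ×
        UnitaryGroup.arch (↥(maximalRealSubfield L)) L (IsCMField.complexConj L) 1
          (Matrix.of fun i j : Fin 1 => if i.val + j.val + 1 = 1 then (1 : L) else 0))}
    {mG : OrbitalMeasureFamily (UnitaryGroup.arch (↥(maximalRealSubfield L)) L (IsCMField.complexConj L) 3 H')}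
    (h : IsArchDeltaTransferExists L H' T mH mG (ArchSmooth L 3 H') (ArchSmooth₂ L)) {κ : ℝ≥0∞} (h0 : κ ≠ 0) (htop : κ ≠ ⊤) :
    IsArchDeltaTransferExists L H' T (HSMul.hSMul κ mH) mG (ArchSmooth L 3 H') (ArchSmooth₂ L) :=
  IsDeltaTransferExistsRel.smul_measure_left h (fun z _ hfH => ArchSmooth₂.smul L hfH z) h0 htop

variable (T : ArchTransferFactor L H')
  [MeasurableSpace (UnitaryGroup.arch (↥(maximalRealSubfield L)) L (IsCMField.complexConj L) 3 H')]
  [BorelSpace (UnitaryGroup.arch (↥(maximalRealSubfield L)) L (IsCMField.complexConj L) 3 H')]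
  [MeasurableSpace (UnitaryGroup.arch (↥(maximalRealSubfield L)) L (IsCMField.complexConj L) 3
    (Matrix.of fun i j : Fin 3 => if i.val + j.val + 1 = 3 then (1 : L) else 0))]
  [BorelSpace (UnitaryGroup.arch (↥(maximalRealSubfield L)) L (IsCMField.complexConj L) 3
    (Matrix.of fun i j : Fin 3 => if i.val + j.val + 1 = 3 then (1 : L) else 0))]
  [MeasurableSpace (UnitaryGroup.arch (↥(maximalRealSubfield L)) L (IsCMField.complexConj L) 2
          (Matrix.of fun i j : Fin 2 => if i.val + j.val + 1 = 2 then (1 : L) else 0) ×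
        UnitaryGroup.arch (↥(maximalRealSubfield L)) L (IsCMField.complexConj L) 1
          (Matrix.of fun i j : Fin 1 => if i.val + j.val + 1 = 1 then (1 : L) else 0))]
  [BorelSpace (UnitaryGroup.arch (↥(maximalRealSubfield L)) L (IsCMField.complexConj L) 2
          (Matrix.of fun i j : Fin 2 => if i.val + j.val + 1 = 2 then (1 : L) else 0) ×
        UnitaryGroup.arch (↥(maximalRealSubfield L)) L (IsCMField.complexConj L) 1
          (Matrix.of fun i j : Fin 1 => if i.val + j.val + 1 = 1 then (1 : L) else 0))]

/-! ## §2 #77 is Haar-normalisation-free -/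

/-- **#77 UNDER INDEPENDENT RESCALINGS OF THE THREE HAAR MEASURES**: for Haar right-invariant `ν′, ν, ν_H` and `c′, c, c_H ≠ 0`,
`ArchTransfersExistCanonical L H′ T ν′ ν ν_H → ArchTransfersExistCanonical L H′ T (c′•ν′) (c•ν) (c_H•ν_H)` — the witnesses `(m′, m, m_H)` rescale to
`(c′•m′, c•m, c_H•m_H)` with the same torus measures, the test-function partners absorbing the scalars.  Contrast: the central-value clause (S-d) tolerates
only `c′ = c` (★ `ArchCentralValueTransfer.measure_eq`, ★ `ArchCentralValueTransfer.nnreal_smul`).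
[cite: Rogawski1990, §1.7 p. 6; §14.2 (14.2.1) pp. 232–233; §14.3 pp. 233–234; §4.3 (4.3.1) p. 43] [cite: DeitmarEchterhoff2014, Thm. 1.5.3] -/
theorem ArchTransfersExistCanonical.nnreal_smul
    (ν' : Measure (UnitaryGroup.arch (↥(maximalRealSubfield L)) L (IsCMField.complexConj L) 3 H'))
    (ν : Measure (UnitaryGroup.arch (↥(maximalRealSubfield L)) L (IsCMField.complexConj L) 3
    (Matrix.of fun i j : Fin 3 => if i.val + j.val + 1 = 3 then (1 : L) else 0)))
    (νH : Measure (UnitaryGroup.arch (↥(maximalRealSubfield L)) L (IsCMField.complexConj L) 2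
          (Matrix.of fun i j : Fin 2 => if i.val + j.val + 1 = 2 then (1 : L) else 0) ×
        UnitaryGroup.arch (↥(maximalRealSubfield L)) L (IsCMField.complexConj L) 1
          (Matrix.of fun i j : Fin 1 => if i.val + j.val + 1 = 1 then (1 : L) else 0)))
    [ν'.IsHaarMeasure] [ν'.IsMulRightInvariant] [ν.IsHaarMeasure] [ν.IsMulRightInvariant] [νH.IsHaarMeasure] [νH.IsMulRightInvariant]
    (h : ArchTransfersExistCanonical L H' T ν' ν νH) {c' c cH : ℝ≥0} (hc' : c' ≠ 0) (hc : c ≠ 0) (hcH : cH ≠ 0) :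
    ArchTransfersExistCanonical L H' T (c' • ν') (c • ν) (cH • νH) := by
  -- the orbit σ-algebras are Borel (as inside ★ `ArchTransfersExistCanonical`), fixed as local instances so that every synthesis below agrees
  letI iGpm : ∀ γ' : UnitaryGroup.arch (↥(maximalRealSubfield L)) L (IsCMField.complexConj L) 3 H',
      MeasurableSpace (UnitaryGroup.arch (↥(maximalRealSubfield L)) L (IsCMField.complexConj L) 3 H' ⧸
        Subgroup.centralizer ({γ'} : Set (UnitaryGroup.arch (↥(maximalRealSubfield L)) L (IsCMField.complexConj L) 3 H'))) :=
    fun _ => borel _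
  haveI iGpb : ∀ γ' : UnitaryGroup.arch (↥(maximalRealSubfield L)) L (IsCMField.complexConj L) 3 H',
      BorelSpace (UnitaryGroup.arch (↥(maximalRealSubfield L)) L (IsCMField.complexConj L) 3 H' ⧸
        Subgroup.centralizer ({γ'} : Set (UnitaryGroup.arch (↥(maximalRealSubfield L)) L (IsCMField.complexConj L) 3 H'))) :=
    fun _ => ⟨rfl⟩
  letI iGm : ∀ γ : UnitaryGroup.arch (↥(maximalRealSubfield L)) L (IsCMField.complexConj L) 3
        (Matrix.of fun i j : Fin 3 => if i.val + j.val + 1 = 3 then (1 : L) else 0),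
      MeasurableSpace (UnitaryGroup.arch (↥(maximalRealSubfield L)) L (IsCMField.complexConj L) 3
          (Matrix.of fun i j : Fin 3 => if i.val + j.val + 1 = 3 then (1 : L) else 0) ⧸
        Subgroup.centralizer ({γ} : Set (UnitaryGroup.arch (↥(maximalRealSubfield L)) L (IsCMField.complexConj L) 3
          (Matrix.of fun i j : Fin 3 => if i.val + j.val + 1 = 3 then (1 : L) else 0)))) :=
    fun _ => borel _
  haveI iGb : ∀ γ : UnitaryGroup.arch (↥(maximalRealSubfield L)) L (IsCMField.complexConj L) 3
        (Matrix.of fun i j : Fin 3 => if i.val + j.val + 1 = 3 then (1 : L) else 0),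
      BorelSpace (UnitaryGroup.arch (↥(maximalRealSubfield L)) L (IsCMField.complexConj L) 3
          (Matrix.of fun i j : Fin 3 => if i.val + j.val + 1 = 3 then (1 : L) else 0) ⧸
        Subgroup.centralizer ({γ} : Set (UnitaryGroup.arch (↥(maximalRealSubfield L)) L (IsCMField.complexConj L) 3
          (Matrix.of fun i j : Fin 3 => if i.val + j.val + 1 = 3 then (1 : L) else 0)))) :=
    fun _ => ⟨rfl⟩
  letI iHm : ∀ a : (UnitaryGroup.arch (↥(maximalRealSubfield L)) L (IsCMField.complexConj L) 2
        (Matrix.of fun i j : Fin 2 => if i.val + j.val + 1 = 2 then (1 : L) else 0) ×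
      UnitaryGroup.arch (↥(maximalRealSubfield L)) L (IsCMField.complexConj L) 1
        (Matrix.of fun i j : Fin 1 => if i.val + j.val + 1 = 1 then (1 : L) else 0)),
      MeasurableSpace ((UnitaryGroup.arch (↥(maximalRealSubfield L)) L (IsCMField.complexConj L) 2
          (Matrix.of fun i j : Fin 2 => if i.val + j.val + 1 = 2 then (1 : L) else 0) ×
        UnitaryGroup.arch (↥(maximalRealSubfield L)) L (IsCMField.complexConj L) 1
          (Matrix.of fun i j : Fin 1 => if i.val + j.val + 1 = 1 then (1 : L) else 0)) ⧸
        Subgroup.centralizer ({a} : Set (UnitaryGroup.arch (↥(maximalRealSubfield L)) L (IsCMField.complexConj L) 2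
          (Matrix.of fun i j : Fin 2 => if i.val + j.val + 1 = 2 then (1 : L) else 0) ×
        UnitaryGroup.arch (↥(maximalRealSubfield L)) L (IsCMField.complexConj L) 1
          (Matrix.of fun i j : Fin 1 => if i.val + j.val + 1 = 1 then (1 : L) else 0)))) :=
    fun _ => borel _
  haveI iHb : ∀ a : (UnitaryGroup.arch (↥(maximalRealSubfield L)) L (IsCMField.complexConj L) 2
        (Matrix.of fun i j : Fin 2 => if i.val + j.val + 1 = 2 then (1 : L) else 0) ×
      UnitaryGroup.arch (↥(maximalRealSubfield L)) L (IsCMField.complexConj L) 1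
        (Matrix.of fun i j : Fin 1 => if i.val + j.val + 1 = 1 then (1 : L) else 0)),
      BorelSpace ((UnitaryGroup.arch (↥(maximalRealSubfield L)) L (IsCMField.complexConj L) 2
          (Matrix.of fun i j : Fin 2 => if i.val + j.val + 1 = 2 then (1 : L) else 0) ×
        UnitaryGroup.arch (↥(maximalRealSubfield L)) L (IsCMField.complexConj L) 1
          (Matrix.of fun i j : Fin 1 => if i.val + j.val + 1 = 1 then (1 : L) else 0)) ⧸
        Subgroup.centralizer ({a} : Set (UnitaryGroup.arch (↥(maximalRealSubfield L)) L (IsCMField.complexConj L) 2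
          (Matrix.of fun i j : Fin 2 => if i.val + j.val + 1 = 2 then (1 : L) else 0) ×
        UnitaryGroup.arch (↥(maximalRealSubfield L)) L (IsCMField.complexConj L) 1
          (Matrix.of fun i j : Fin 1 => if i.val + j.val + 1 = 1 then (1 : L) else 0)))) :=
    fun _ => ⟨rfl⟩
  intro hherm hanis
  obtain ⟨m', m, mH, t', t, tH, hi, hii, hiii, hiv, hv, hvi, hW', hW, hWH, hC', hC, hC'G, hCH⟩ := h hherm hanis
  have h0' : ((c' : ℝ≥0∞)) ≠ 0 := ENNReal.coe_ne_zero.2 hc'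
  have h0 : ((c : ℝ≥0∞)) ≠ 0 := ENNReal.coe_ne_zero.2 hc
  have h0H : ((cH : ℝ≥0∞)) ≠ 0 := ENNReal.coe_ne_zero.2 hcH
  exact ⟨HSMul.hSMul (c' : ℝ≥0∞) m', HSMul.hSMul (c : ℝ≥0∞) m, HSMul.hSMul (cH : ℝ≥0∞) mH, t', t, tH,
    hi.smul h0' ENNReal.coe_ne_top, hii.smul h0 ENNReal.coe_ne_top, hiii.smul h0H ENNReal.coe_ne_top, hiv,
    (IsArchInnerTransferExists.smul_measure_left L H' hv _).smul_measure_right L H' h0 ENNReal.coe_ne_top,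
    (IsArchDeltaTransferExists.smul_measure_right L H' hvi _).smul_measure_left L H' h0H ENNReal.coe_ne_top,
    hW'.smul_of_eq_nnreal_smul hc' rfl, hW.smul_of_eq_nnreal_smul hc rfl, hWH.smul_of_eq_nnreal_smul hcH rfl, hC', hC, hC'G, hCH⟩

/-- **#77 IS HAAR-NORMALISATION-FREE**: for any two triples `(ν′₁, ν₁, ν_{H,1})`, `(ν′₂, ν₂, ν_{H,2})` of Haar right-invariant measures on `G′_∞`, `G_∞`, `H_∞`,
`ArchTransfersExistCanonical L H′ T ν′₁ ν₁ ν_{H,1} → ArchTransfersExistCanonical L H′ T ν′₂ ν₂ ν_{H,2}` (the three Haar scalar factors are positive): the letter is a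
property of `(L, H′, T)` alone — ★ `TransferFactsCanonical` ED. 3's remark «no absolute normalisation is asserted at `∞`», kernel-checked.
[cite: Rogawski1990, §1.7 p. 6; §14.2 (14.2.1) pp. 232–233] [cite: DeitmarEchterhoff2014, Thm. 1.5.3] -/
theorem ArchTransfersExistCanonical.of_isHaarMeasure
    (ν'₁ ν'₂ : Measure (UnitaryGroup.arch (↥(maximalRealSubfield L)) L (IsCMField.complexConj L) 3 H'))
    (ν₁ ν₂ : Measure (UnitaryGroup.arch (↥(maximalRealSubfield L)) L (IsCMField.complexConj L) 3
    (Matrix.of fun i j : Fin 3 => if i.val + j.val + 1 = 3 then (1 : L) else 0)))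
    (νH₁ νH₂ : Measure (UnitaryGroup.arch (↥(maximalRealSubfield L)) L (IsCMField.complexConj L) 2
          (Matrix.of fun i j : Fin 2 => if i.val + j.val + 1 = 2 then (1 : L) else 0) ×
        UnitaryGroup.arch (↥(maximalRealSubfield L)) L (IsCMField.complexConj L) 1
          (Matrix.of fun i j : Fin 1 => if i.val + j.val + 1 = 1 then (1 : L) else 0)))
    [ν'₁.IsHaarMeasure] [ν'₁.IsMulRightInvariant] [ν₁.IsHaarMeasure] [ν₁.IsMulRightInvariant] [νH₁.IsHaarMeasure] [νH₁.IsMulRightInvariant]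
    [ν'₂.IsHaarMeasure] [ν'₂.IsMulRightInvariant] [ν₂.IsHaarMeasure] [ν₂.IsMulRightInvariant] [νH₂.IsHaarMeasure] [νH₂.IsMulRightInvariant]
    (h : ArchTransfersExistCanonical L H' T ν'₁ ν₁ νH₁) : ArchTransfersExistCanonical L H' T ν'₂ ν₂ νH₂ := by
  have e' := isHaarMeasure_eq_haarScalarFactor_smul ν'₁ ν'₂
  have e := isHaarMeasure_eq_haarScalarFactor_smul ν₁ ν₂
  have eH := isHaarMeasure_eq_haarScalarFactor_smul νH₁ νH₂
  have key := ArchTransfersExistCanonical.nnreal_smul L H' T ν'₁ ν₁ νH₁ h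
    (Measure.haarScalarFactor_pos_of_isHaarMeasure ν'₂ ν'₁).ne' (Measure.haarScalarFactor_pos_of_isHaarMeasure ν₂ ν₁).ne'
    (Measure.haarScalarFactor_pos_of_isHaarMeasure νH₂ νH₁).ne'
  revert key
  -- transport along the three equalities of measures (instance arguments are propositions)
  have aux : ∀ (μ' : Measure (UnitaryGroup.arch (↥(maximalRealSubfield L)) L (IsCMField.complexConj L) 3 H')) (μ : Measure (UnitaryGroup.arch (↥(maximalRealSubfield L)) L (IsCMField.complexConj L) 3
    (Matrix.of fun i j : Fin 3 => if i.val + j.val + 1 = 3 then (1 : L) else 0))) (μH : Measure (UnitaryGroup.arch (↥(maximalRealSubfield L)) L (IsCMField.complexConj L) 2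
          (Matrix.of fun i j : Fin 2 => if i.val + j.val + 1 = 2 then (1 : L) else 0) ×
        UnitaryGroup.arch (↥(maximalRealSubfield L)) L (IsCMField.complexConj L) 1
          (Matrix.of fun i j : Fin 1 => if i.val + j.val + 1 = 1 then (1 : L) else 0)))
      [IsFiniteMeasureOnCompacts μ'] [μ'.IsMulRightInvariant] [IsFiniteMeasureOnCompacts μ] [μ.IsMulRightInvariant]
      [IsFiniteMeasureOnCompacts μH] [μH.IsMulRightInvariant],
      μ' = ν'₂ → μ = ν₂ → μH = νH₂ → ArchTransfersExistCanonical L H' T μ' μ μH → ArchTransfersExistCanonical L H' T ν'₂ ν₂ νH₂ := by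
    intro μ' μ μH _ _ _ _ _ _ h1 h2 h3 hμ
    subst h1 h2 h3
    exact hμ
  exact aux _ _ _ e'.symm e.symm eH.symm

end Arch

end Literature.NumberTheory.Rogawski1990

end
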